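import Mathlib
import Summits.ValiantsHypothesis.ValiantsHypothesis.Theses.BarrierLever
import Literature.Barriers.ValiantsHypothesis.AlgebraicNaturalProofs
import Literature.Computability.AlgebraicComplexity.ArithCircuitProofs
import Literature.Computability.AlgebraicComplexity.HomogeneousComponentsComplexity
import Summits.ValiantsHypothesis.ValiantsHypothesis.Theorems.BarrierLeverSuccinctHittingSetsForVPLevelOne
import Summits.ValiantsHypothesis.ValiantsHypothesis.Theorems.BarrierLeverSuccinctHittingSetsForVPDimensionCount
import HarnessLib

/-!
# Crux `BarrierLever.SuccinctHittingSetsForVP` (stmt-ValiantsHypothesis-14610), line `registered` —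
REDUCTION OF THE HEART TO HOMOGENEOUS DISTINGUISHERS (lead c4)

**What is proved (unconditional; a REDUCTION of the open stub, it does NOT close the item).** The crux
(FSV18 Question 6 over `ℂ`, regime `d = n`) is EQUIVALENT to its restriction to HOMOGENEOUS
distinguishers of a fixed level:

* `levelOne_of_homogeneousLevelFour` : if for some `b`, eventually in `n`, `SmallCircuits ℂ n b` hits
  every nonzero HOMOGENEOUS level-4 distinguisher, then level one of Question 6 holds (hence, by the
  landed level collapse `succinctHittingSetsForVP_iff_levelOne`, p144631, every level).
* `succinctHittingSetsForVP_iff_homogeneous` : crux `↔ ∃ b n₀, ∀ n ≥ n₀, IsSuccinctHittingSet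
  (degLEMonomials n) (SmallCircuits ℂ n b) (Distinguishers ℂ n 4 ∩ {D | D homogeneous})`.
* `stub_homogeneousReduction` : the registered stub (arrow form).

**Proof.** `SmallCircuits` is closed under scaling up to one gate (`C t * f`, `smul_mem_smallCircuits`),
and on the line `t ↦ t • coeff(f)` a distinguisher `D` restricts to the univariate polynomial
`Σ_j t^j D_j(coeff f)` whose coefficients are the values of the HOMOGENEOUS COMPONENTS `D_j`
(`eval_smul_eq_sum`); if `D ≠ 0` vanishes on all of `SmallCircuits ℂ n (b+1)`, every `D_j` vanishes
on `SmallCircuits ℂ n b` (a nonzero univariate polynomial over `ℂ` has a non-root), and a nonzero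
`D_j` is a homogeneous distinguisher of size `≤ (N+2)² · L(D) ≤ N⁴` by Strassen's homogenisation
(tree: `complexity_homogeneousComponent_le_sq_mul`, Bürgisser–Clausen–Shokrollahi (7.1)) and degree
`≤ N`. So an equation at level one yields a HOMOGENEOUS equation at level four, one size exponent
down. (The same argument with the scaling `x ↦ t x` of the variables would further reduce to
distinguishers isobaric for the weight `c_μ ↦ |μ|`; not formalised — the tree has no size bound for
weighted homogeneous components.) Axioms: `propext`, `Classical.choice`, `Quot.sound`.

References: [ForbesShpilkaVolk2018] Question 6, §1.2; [Burgisser2000]/BCS (7.1) (homogeneous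
components of a circuit).
-/

-- layout Summits/ValiantsHypothesis/ValiantsHypothesis forces the duplicated namespace component
set_option linter.dupNamespace false

namespace Summit.ValiantsHypothesis.ValiantsHypothesis.Theorems.BarrierLever.SuccinctHittingSetsForVP

open Literature.Barriers.ValiantsHypothesis Literature.Computability.AlgebraicComplexity MvPolynomial

namespace Homogeneous

variable {ι : Type*}

/-- **Scaling a homogeneous component**: `D_j(t • c) = t^j · D_j(c)`. [folklore] -/
theorem eval_smul_homogeneousComponent (c : ι → ℂ) (t : ℂ) (D : MvPolynomial ι ℂ) (j : ℕ) :
    eval (fun i => t * c i) (homogeneousComponent j D) =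
      t ^ j * eval c (homogeneousComponent j D) := by
  classical
  set φ := homogeneousComponent j D with hφ
  have hhom : φ.IsHomogeneous j := homogeneousComponent_isHomogeneous j D
  conv_lhs => rw [φ.as_sum]
  conv_rhs => rw [φ.as_sum]
  rw [map_sum, map_sum, Finset.mul_sum]
  refine Finset.sum_congr rfl fun s hs => ?_
  have hdeg : s.degree = j := by
    have h := hhom (mem_support_iff.mp hs)
    simpa [Finsupp.weight, Finsupp.degree_apply, Finsupp.linearCombination_apply, Finsupp.sum] using h
  rw [eval_monomial, eval_monomial, Finsupp.prod, Finsupp.prod]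
  simp_rw [mul_pow]
  rw [Finset.prod_mul_distrib, Finset.prod_pow_eq_pow_sum, ← Finsupp.degree_apply, hdeg]
  ring

/-- **The restriction of `D` to the line `t ↦ t • c`** is `Σ_{j ≤ deg D} t^j D_j(c)`. [folklore] -/
theorem eval_smul_eq_sum (c : ι → ℂ) (t : ℂ) (D : MvPolynomial ι ℂ) :
    eval (fun i => t * c i) D =
      ∑ j ∈ Finset.range (D.totalDegree + 1), t ^ j * eval c (homogeneousComponent j D) := by
  conv_lhs => rw [← sum_homogeneousComponent D]
  rw [map_sum]
  exact Finset.sum_congr rfl fun j _ => eval_smul_homogeneousComponent c t D j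

/-- **A nonzero component is seen on the line**: if `D_j(c) ≠ 0` then `D(t • c) ≠ 0` for some
`t ∈ ℂ` (a nonzero univariate polynomial over `ℂ` has a non-root). [folklore] -/
theorem exists_scale_eval_ne_zero {c : ι → ℂ} {D : MvPolynomial ι ℂ} {j : ℕ}
    (h : eval c (homogeneousComponent j D) ≠ 0) : ∃ t : ℂ, eval (fun i => t * c i) D ≠ 0 := by
  classical
  -- the univariate restriction
  set P : Polynomial ℂ :=
    ∑ i ∈ Finset.range (D.totalDegree + 1),
      Polynomial.C (eval c (homogeneousComponent i D)) * Polynomial.X ^ i with hP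
  have hjle : j ≤ D.totalDegree := by
    by_contra hlt
    push Not at hlt
    exact h (by rw [homogeneousComponent_eq_zero j D hlt, map_zero])
  have hcoeff : P.coeff j = eval c (homogeneousComponent j D) := by
    rw [hP, Polynomial.finsetSum_coeff]
    simp only [Polynomial.coeff_C_mul, Polynomial.coeff_X_pow, mul_ite, mul_one, mul_zero]
    rw [Finset.sum_ite_eq (Finset.range (D.totalDegree + 1)) j, if_pos (Finset.mem_range.mpr (by omega))]
  have hP0 : P ≠ 0 := fun h0 => h (by rw [← hcoeff, h0, Polynomial.coeff_zero])
  have hPeval : ∀ t, P.eval t = eval (fun i => t * c i) D := by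
    intro t
    rw [eval_smul_eq_sum, hP, Polynomial.eval_finsetSum]
    refine Finset.sum_congr rfl fun i _ => ?_
    rw [Polynomial.eval_mul, Polynomial.eval_C, Polynomial.eval_pow, Polynomial.eval_X, mul_comm]
  by_contra hall
  push Not at hall
  apply hP0
  apply Polynomial.eq_zero_of_infinite_isRoot
  have huniv : {x | P.IsRoot x} = Set.univ := by
    ext t
    simp only [Set.mem_setOf_eq, Set.mem_univ, Polynomial.IsRoot, hPeval, hall]
  rw [huniv]
  exact Set.infinite_univ

/-- **Scaling closure of the simple class**: `C t * f ∈ SmallCircuits ℂ n (b+1)` whenever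
`f ∈ SmallCircuits ℂ n b` and `n ≥ 2` (one more gate). [cite: ForbesShpilkaVolk2018, Cor. 5] -/
theorem smul_mem_smallCircuits {n b : ℕ} (hn : 2 ≤ n) {f : MvPolynomial (Fin n) ℂ}
    (hf : f ∈ SmallCircuits ℂ n b) (t : ℂ) : C t * f ∈ SmallCircuits ℂ n (b + 1) := by
  refine ⟨(totalDegree_mul _ _).trans (by rw [totalDegree_C, zero_add]; exact hf.1), ?_⟩
  calc complexity (C t * f) ≤ complexity (C t : MvPolynomial (Fin n) ℂ) + complexity f + 1 :=
        complexity_mul_le_holds _ _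
    _ ≤ 0 + n ^ b + 1 := by rw [complexity_C_holds]; exact Nat.add_le_add_right (Nat.add_le_add_left hf.2 _) 1
    _ ≤ n ^ (b + 1) := by
        rw [zero_add, pow_succ]
        have h1 : 1 ≤ n ^ b := Nat.one_le_pow _ _ (by omega)
        nlinarith

/-- The coefficient vector of `C t * f` is `t •` that of `f`. [folklore] -/
theorem coeffVector_C_mul {n : ℕ} (t : ℂ) (f : MvPolynomial (Fin n) ℂ) :
    coeffVector (degLEMonomials n) (C t * f) = fun μ => t * coeffVector (degLEMonomials n) f μ := by
  funext μ
  simp [coeffVector_apply, coeff_C_mul]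

/-- Arithmetic: `(N+2)² · N ≤ N⁴` for `N ≥ 4`. [folklore] -/
theorem sq_mul_le_pow_four {N : ℕ} (hN : 4 ≤ N) : (N + 2) ^ 2 * N ≤ N ^ 4 := by
  have h1 : (N + 2) ^ 2 ≤ 4 * (N * N) := by nlinarith
  have h2 : 4 * (N * N) ≤ N * (N * N) := Nat.mul_le_mul_right _ hN
  calc (N + 2) ^ 2 * N ≤ N * (N * N) * N := Nat.mul_le_mul_right N (h1.trans h2)
    _ = N ^ 4 := by ring

/-- `4 ≤ C(2n, n)` for `n ≥ 2`. [folklore] -/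
theorem four_le_choose {n : ℕ} (hn : 2 ≤ n) : 4 ≤ Nat.choose (2 * n) n := by
  rcases Nat.lt_or_ge n 4 with h | h
  · interval_cases n <;> decide
  · exact le_trans (by norm_num) ((Nat.pow_le_pow_right (by norm_num) h).trans
      (LowDegreeEquations.two_pow_le_choose h))

/-- **A homogeneous component of a level-one distinguisher is a level-4 distinguisher** (`n ≥ 2`):
size `≤ (j+2)² L(D) ≤ (N+2)² N ≤ N⁴` (Strassen's homogenisation), degree `≤ j ≤ N`.
[cite: ForbesShpilkaVolk2018, §1.2] -/
theorem homogeneousComponent_mem_distinguishers {n : ℕ} (hn : 2 ≤ n)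
    {D : MvPolynomial (degLEMonomials n) ℂ} (hD : D ∈ Distinguishers ℂ n 1) {j : ℕ}
    (hj : j ≤ D.totalDegree) : homogeneousComponent j D ∈ Distinguishers ℂ n 4 := by
  obtain ⟨hL, hdeg⟩ := hD
  rw [pow_one] at hL hdeg
  have hN := four_le_choose hn
  set N := Nat.choose (2 * n) n with hNdef
  have hjN : j ≤ N := hj.trans hdeg
  refine ⟨?_, ?_⟩
  · calc complexity (homogeneousComponent j D) ≤ (j + 2) ^ 2 * complexity D :=
          complexity_homogeneousComponent_le_sq_mul D j
      _ ≤ (N + 2) ^ 2 * N := Nat.mul_le_mul (Nat.pow_le_pow_left (by omega) 2) hL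
      _ ≤ N ^ 4 := sq_mul_le_pow_four hN
  · calc (homogeneousComponent j D).totalDegree ≤ j :=
          (homogeneousComponent_isHomogeneous j D).totalDegree_le
      _ ≤ N := hjN
      _ = N ^ 1 := (pow_one N).symm
      _ ≤ N ^ 4 := Nat.pow_le_pow_right (by omega) (by norm_num)

end Homogeneous

open Homogeneous

/-- **Level one from HOMOGENEOUS level four.** If for some `b`, eventually in `n`,
`SmallCircuits ℂ n b` hits every nonzero homogeneous level-4 distinguisher, then level one of FSV
Question 6 holds (with size exponent `b + 1`): a level-one `D ≠ 0` has a nonzero homogeneous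
component `D_j`, a homogeneous level-4 distinguisher, hit by some small `f`; then `D(t • coeff f) ≠ 0`
for some `t`, and `t • coeff f = coeff(C t * f)` with `C t * f` small. [cite: ForbesShpilkaVolk2018, Question 6] -/
theorem levelOne_of_homogeneousLevelFour
    (h : ∃ b n₀ : ℕ, ∀ n : ℕ, n₀ ≤ n →
      IsSuccinctHittingSet (degLEMonomials n) (SmallCircuits ℂ n b)
        (Distinguishers ℂ n 4 ∩ {D | D.IsHomogeneous D.totalDegree})) :
    ∃ b n₀ : ℕ, ∀ n : ℕ, n₀ ≤ n →
      IsSuccinctHittingSet (degLEMonomials n) (SmallCircuits ℂ n b) (Distinguishers ℂ n 1) := by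
  obtain ⟨b, n₀, hb⟩ := h
  refine ⟨b + 1, max n₀ 2, fun n hn D hD hD0 => ?_⟩
  have hn₀ : n₀ ≤ n := le_trans (le_max_left _ _) hn
  have hn2 : 2 ≤ n := le_trans (le_max_right _ _) hn
  -- a nonzero homogeneous component
  obtain ⟨j, hjle, hj0⟩ : ∃ j, j ≤ D.totalDegree ∧ homogeneousComponent j D ≠ 0 := by
    by_contra hcon
    push Not at hcon
    apply hD0
    rw [← sum_homogeneousComponent D]
    exact Finset.sum_eq_zero fun j hj => hcon j (by have := Finset.mem_range.mp hj; omega)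
  have hmem : homogeneousComponent j D ∈
      Distinguishers ℂ n 4 ∩ {D : MvPolynomial (degLEMonomials n) ℂ | D.IsHomogeneous D.totalDegree} := by
    refine ⟨homogeneousComponent_mem_distinguishers hn2 hD hjle, ?_⟩
    show (homogeneousComponent j D).IsHomogeneous (homogeneousComponent j D).totalDegree
    rw [(homogeneousComponent_isHomogeneous j D).totalDegree hj0]
    exact homogeneousComponent_isHomogeneous j D
  obtain ⟨f, hf, hne⟩ := hb n hn₀ _ hmem hj0
  obtain ⟨t, ht⟩ := exists_scale_eval_ne_zero hne
  refine ⟨C t * f, smul_mem_smallCircuits hn2 hf t, ?_⟩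
  rwa [coeffVector_C_mul]

/-- **The crux is equivalent to its homogeneous level-four case.** FSV Question 6 over `ℂ` (regime
`d = n`) holds iff for some `b`, eventually in `n`, `SmallCircuits ℂ n b` hits every nonzero
HOMOGENEOUS distinguisher of size and degree `≤ N⁴`: equations for `VP` may be assumed homogeneous.
[cite: ForbesShpilkaVolk2018, Question 6] -/
theorem succinctHittingSetsForVP_iff_homogeneous :
    Summit.ValiantsHypothesis.ValiantsHypothesis.Theses.BarrierLever.SuccinctHittingSetsForVP ↔
      ∃ b n₀ : ℕ, ∀ n : ℕ, n₀ ≤ n →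
        IsSuccinctHittingSet (degLEMonomials n) (SmallCircuits ℂ n b)
          (Distinguishers ℂ n 4 ∩ {D | D.IsHomogeneous D.totalDegree}) := by
  constructor
  · intro h
    obtain ⟨b, n₀, hb⟩ := (show Literature.Barriers.ValiantsHypothesis.SuccinctHittingSetsForVP ℂ from h) 4
    exact ⟨b, n₀, fun n hn => (hb n hn).mono le_rfl Set.inter_subset_left⟩
  · intro h
    exact succinctHittingSetsForVP_iff_levelOne.mpr (levelOne_of_homogeneousLevelFour h)

/-- **Homogeneous equations suffice (contrapositive form)**: if level one FAILS for the size exponent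
`b + 1` at `n ≥ 2` — some nonzero level-one `D` vanishes on all of `SmallCircuits ℂ n (b+1)` — then
some nonzero HOMOGENEOUS level-4 distinguisher (a homogeneous component of `D`) vanishes on all of
`SmallCircuits ℂ n b`. [cite: ForbesShpilkaVolk2018, Thm. 4 and Question 6] -/
theorem exists_homogeneous_equation {n b : ℕ} (hn : 2 ≤ n)
    {D : MvPolynomial (degLEMonomials n) ℂ} (hD : D ∈ Distinguishers ℂ n 1) (hD0 : D ≠ 0)
    (hvan : ∀ f ∈ SmallCircuits ℂ n (b + 1), eval (coeffVector (degLEMonomials n) f) D = 0) :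
    ∃ E ∈ Distinguishers ℂ n 4, E ≠ 0 ∧ E.IsHomogeneous E.totalDegree ∧
      ∀ f ∈ SmallCircuits ℂ n b, eval (coeffVector (degLEMonomials n) f) E = 0 := by
  obtain ⟨j, hjle, hj0⟩ : ∃ j, j ≤ D.totalDegree ∧ homogeneousComponent j D ≠ 0 := by
    by_contra hcon
    push Not at hcon
    apply hD0
    rw [← sum_homogeneousComponent D]
    exact Finset.sum_eq_zero fun j hj => hcon j (by have := Finset.mem_range.mp hj; omega)
  refine ⟨homogeneousComponent j D, homogeneousComponent_mem_distinguishers hn hD hjle, hj0, ?_, ?_⟩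
  · rw [(homogeneousComponent_isHomogeneous j D).totalDegree hj0]
    exact homogeneousComponent_isHomogeneous j D
  · intro f hf
    by_contra hne
    obtain ⟨t, ht⟩ := exists_scale_eval_ne_zero hne
    apply ht
    rw [← coeffVector_C_mul]
    exact hvan _ (smul_mem_smallCircuits hn hf t)

/-- **Registered stub `stub_homogeneousReduction`** (crux stmt-ValiantsHypothesis-14610, line
`registered`; lead c4): homogeneous level four implies level one (arrow form of
`succinctHittingSetsForVP_iff_homogeneous`). [cite: ForbesShpilkaVolk2018, Question 6] -/
theorem stub_homogeneousReduction :
    (∃ b n₀ : ℕ, ∀ n : ℕ, n₀ ≤ n →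
      IsSuccinctHittingSet (degLEMonomials n) (SmallCircuits ℂ n b)
        (Distinguishers ℂ n 4 ∩ {D | D.IsHomogeneous D.totalDegree})) →
    ∃ b n₀ : ℕ, ∀ n : ℕ, n₀ ≤ n →
      IsSuccinctHittingSet (degLEMonomials n) (SmallCircuits ℂ n b) (Distinguishers ℂ n 1) :=
  levelOne_of_homogeneousLevelFour

end Summit.ValiantsHypothesis.ValiantsHypothesis.Theorems.BarrierLever.SuccinctHittingSetsForVP
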